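import Literature.NumberTheory.LFunctions.KadiriMasterInequality
import Literature.NumberTheory.LFunctions.KadiriBoundaryInequality
import Literature.NumberTheory.LFunctions.KadiriDigammaBounds
import HarnessLib

/-!
# The terms of Kadiri's master inequality made explicit (Acta Arith. 117 (2005), Props. 2.2, 2.3, (3.10); Mossinghoff–Trudgian 2015 §§2–4)

Topic `Literature/NumberTheory/LFunctions`. Everything in this file is PROVED (no named fact, no
definition). `KadiriMaster.master_ineq` bounds `a₁ · Pair(ρ₀)` by `Γ`-terms, pole terms,
`Γ`-remainders and far-zero tails at the points `s_k = σ + ikγ₀`, `s'_k = s_k + δ`. Here each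
ingredient is expressed through quantities a computation can evaluate:

* the real-axis values of the Laplace transform of the test function `f = ηh(η·)`:
  `Re F(x) = L(x/η)`, `L(X) = ∫₀^{d₁} h(u)e^{−Xu} du` (`mtyLaplace θ X`, Ford's closed form `W`
  at real argument), non-increasing in `X`, with `|L(X) − g₁/X| ≤ m/X³` (`X > 0`);
* the kept pair at `ρ₀ = β₀ + iγ₀` (`β_low ≤ β₀ ≤ σ ≤ 1`):
  `Pair(ρ₀) ≥ L((σ−β_low)/η) + L(1/η) − κ[L(δ/η) + L((σ+δ−1+β_low)/η)]`
  (Kadiri (3.10) with the monotonicity of `x ↦ F̃(x,0)`; with `β_low = 1 − η` the first term is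
  `L(1 − w)`, `w = (1−σ)/η`, the ingredient of `K(w, θ)`);
* the pole terms: at `k = 0` exactly `L((σ−1)/η) − κL((σ+δ−1)/η)` (`= W(−w) − κW(…)`), at
  `k ≥ 1` bounded by `(1+κ)(ηg₁ + M*η²)/(kγ₀)²`;
* the `Γ`-terms: Kadiri's Lemma 4.5 (`KadiriDigamma.T1_sub_mul_T1_le`, `_zero`) in the notation
  `kadiriT1`.

## References

* H. Kadiri, Acta Arith. 117 (2005) = arXiv:math/0401238, Lemma 3.2, Prop. 2.2, Prop. 2.3,
  (3.10), Lemma 4.5. (`Kadiri2005`)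
* M. J. Mossinghoff, T. S. Trudgian, J. Number Theory 157 (2015) = arXiv:1410.3926, §2 (2.2),
  §4 (`C₁`, `C₂`, `C₃`). (`MossinghoffTrudgian2015`)
-/

noncomputable section

open Complex Real MeasureTheory Set

namespace Literature.NumberTheory.LFunctions

namespace KadiriExplicit

open NicolasJExplicit

variable {θ η : ℝ}

/-! ## Real-axis values of the Laplace transform -/

/-- The scaled kernel integral as a real integral cast to `ℂ` (real argument). [folklore] -/
theorem integral_mtyH1_cexp_ofReal (θ X : ℝ) :
    ∫ u in (0 : ℝ)..mtyD1 θ, (mtyH1 1 θ u : ℂ) * Complex.exp (-((X : ℂ) * u)) =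
      ((mtyLaplace θ X : ℝ) : ℂ) := by
  unfold mtyLaplace
  rw [← intervalIntegral.integral_ofReal]
  refine intervalIntegral.integral_congr fun u _ ↦ ?_
  push_cast
  ring

/-- **`Re F(x) = L(x/η)`** for the test function `f = ηh(η·)` and real `x`:
`∫₀^∞ f(t)e^{−xt} dt = ∫₀^{d₁} h(u) e^{−(x/η)u} du`. [cite: Kadiri2005, §2.2 (2.4)] -/
theorem re_fordLaplace_ofReal (hθ : 0 < θ) (hθ' : θ < π / 2) (hη : 0 < η) (x : ℝ) :
    (fordLaplace (kadiriTest θ η) (x : ℂ)).re = mtyLaplace θ (x / η) := by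
  rw [KadiriTest.fordLaplace_eq hθ hθ' hη, kadiri_f_laplace_eq_scaled hη,
    show (x : ℂ) / (η : ℂ) = ((x / η : ℝ) : ℂ) by push_cast; rfl, integral_mtyH1_cexp_ofReal,
    Complex.ofReal_re]

/-- The same at a point written `x + 0·i`-free but with a vanishing imaginary coordinate:
`Re F(x + (t − t)i) = L(x/η)`. [folklore] -/
theorem re_fordLaplace_sub_self (hθ : 0 < θ) (hθ' : θ < π / 2) (hη : 0 < η) (x t : ℝ) :
    (fordLaplace (kadiriTest θ η) ((x : ℂ) + ((t - t : ℝ) : ℂ) * I)).re = mtyLaplace θ (x / η) := by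
  rw [sub_self, Complex.ofReal_zero, zero_mul, add_zero, re_fordLaplace_ofReal hθ hθ' hη]

/-- `L(X) ≥ 0` (`h ≥ 0` on `[0, d₁]`). [folklore] -/
theorem mtyLaplace_nonneg (hθ : 0 < θ) (hθ' : θ < π / 2) (X : ℝ) : 0 ≤ mtyLaplace θ X := by
  unfold mtyLaplace
  have hD := KadiriTest.mtyD1_pos hθ hθ'
  refine intervalIntegral.integral_nonneg hD.le fun u hu ↦ ?_
  exact mul_nonneg (mtyH1_one_nonneg hθ hθ' hu.1 hu.2) (Real.exp_nonneg _)

/-- **Third-order real-axis bound** `|L(X) − g₁/X| ≤ m/X³` (`X > 0`, `m ≥ max|h''|`).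
[cite: Kadiri2005, Lemma 3.2] -/
theorem abs_mtyLaplace_sub_le (hθ : 0 < θ) (hθ' : θ < π / 2) {m X : ℝ} (hX : 0 < X)
    (hm : ∀ u ∈ Icc 0 (mtyD1 θ), |mtyH1Deriv2 1 θ u| ≤ m) :
    |mtyLaplace θ X - fordSmoothW0 θ / X| ≤ m / X ^ 3 := by
  have hz : (X : ℂ) ≠ 0 := Complex.ofReal_ne_zero.2 hX.ne'
  have h := kadiri_lemma32_mtyH1 hθ hθ' hz
  rw [integral_mtyH1_cexp_ofReal, Complex.ofReal_re, Complex.ofReal_re, Complex.norm_real,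
    Real.norm_eq_abs, abs_of_pos hX] at h
  have e1 : fordSmoothW0 θ * X / X ^ 2 = fordSmoothW0 θ / X := by field_simp
  rw [e1] at h
  refine h.trans ?_
  have hM := KadiriBoundary.mtyM_le_div hθ hθ' hm hX
  calc mtyM θ X / X ^ 2 ≤ (m / X) / X ^ 2 := div_le_div_of_nonneg_right hM (by positivity)
    _ = m / X ^ 3 := by field_simp

/-! ## The kept pair -/

/-- **The kept pair made explicit** (Kadiri (3.10) with the monotonicity of `x ↦ F̃(x, 0)`): if
`β_low ≤ β ≤ σ ≤ 1`, `β ≤ 1` and `κ ≥ 0`, then at `t = γ`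
`Pair = L((σ−β)/η) + L((σ−1+β)/η) − κ[L((σ+δ−β)/η) + L((σ+δ−1+β)/η)]
      ≥ L((σ−β_low)/η) + L(1/η) − κ[L(δ/η) + L((σ+δ−1+β_low)/η)]`. [cite: Kadiri2005, (3.10)] -/
theorem pairVal_self_ge (hθ : 0 < θ) (hθ' : θ < π / 2) (hη : 0 < η) {σ δ κ t β βlow : ℝ}
    (hβ1 : βlow ≤ β) (hβ2 : β ≤ σ) (hβ3 : β ≤ 1) (hσ1 : σ ≤ 1) (hκ : 0 ≤ κ) :
    mtyLaplace θ ((σ - βlow) / η) + mtyLaplace θ (1 / η) -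
        κ * (mtyLaplace θ (δ / η) + mtyLaplace θ ((σ + δ - 1 + βlow) / η)) ≤
      KadiriZeroSum.pairVal θ η σ δ κ t β t := by
  unfold KadiriZeroSum.pairVal
  simp only [re_fordLaplace_sub_self hθ hθ' hη]
  have hA := antitone_mtyLaplace hθ hθ'
  have h1 : mtyLaplace θ ((σ - βlow) / η) ≤ mtyLaplace θ ((σ - β) / η) :=
    hA (div_le_div_of_nonneg_right (by linarith) hη.le)
  have h2 : mtyLaplace θ (1 / η) ≤ mtyLaplace θ ((σ - 1 + β) / η) :=
    hA (div_le_div_of_nonneg_right (by linarith) hη.le)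
  have h3 : mtyLaplace θ ((σ + δ - β) / η) ≤ mtyLaplace θ (δ / η) :=
    hA (div_le_div_of_nonneg_right (by linarith) hη.le)
  have h4 : mtyLaplace θ ((σ + δ - 1 + β) / η) ≤ mtyLaplace θ ((σ + δ - 1 + βlow) / η) :=
    hA (div_le_div_of_nonneg_right (by linarith) hη.le)
  nlinarith [mul_le_mul_of_nonneg_left (add_le_add h3 h4) hκ]

/-! ## The pole terms -/

/-- **The pole terms at `k = 0`, exactly**: `Re F(σ − 1) = L((σ−1)/η)` (`= W(−w)`), and the same
at `σ + δ`. [cite: Kadiri2005, Prop. 2.3] -/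
theorem re_fordLaplace_pole_zero (hθ : 0 < θ) (hθ' : θ < π / 2) (hη : 0 < η) (x γ₀ : ℝ) :
    (fordLaplace (kadiriTest θ η) ((x : ℂ) + ((((0 : ℕ) : ℝ) * γ₀ : ℝ) : ℂ) * I - 1)).re =
      mtyLaplace θ ((x - 1) / η) := by
  rw [show (x : ℂ) + ((((0 : ℕ) : ℝ) * γ₀ : ℝ) : ℂ) * I - 1 = ((x - 1 : ℝ) : ℂ) by push_cast; ring,
    re_fordLaplace_ofReal hθ hθ' hη]

/-- **The pole terms at `k ≥ 1`** (Prop. 2.3 / Prop. 4.6 shape): for `|x − 1| ≤ 1`, `t ≠ 0` and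
`M((x−1)/η) ≤ M*`, `|Re F(x − 1 + it)| ≤ (ηg₁ + M*η²)/t²`. [cite: Kadiri2005, Prop. 2.3] -/
theorem abs_re_fordLaplace_pole_le (hθ : 0 < θ) (hθ' : θ < π / 2) (hη : 0 < η) {x t Mst : ℝ}
    (hx : |x - 1| ≤ 1) (ht : t ≠ 0) (hM : mtyM θ ((x - 1) / η) ≤ Mst) :
    |(fordLaplace (kadiriTest θ η) ((x : ℂ) + (t : ℂ) * I - 1)).re| ≤
      (η * fordSmoothW0 θ + Mst * η ^ 2) / t ^ 2 := by
  have e : (x : ℂ) + (t : ℂ) * I - 1 = ((x - 1 : ℝ) : ℂ) + (t : ℂ) * I := by push_cast; ring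
  rw [e]
  have hH := KadiriZeroSum.abs_H_le hθ hθ' hη (x := x - 1) ht hM
  have hg0 : 0 < fordSmoothW0 θ := fordSmoothW0_pos hθ hθ'
  have ht2 : 0 < t ^ 2 := by positivity
  have hq : 0 < (x - 1) ^ 2 + t ^ 2 := by positivity
  -- the main term `ηg₁(x−1)/((x−1)² + t²)` is at most `ηg₁/t²` in absolute value
  have hmain : |η * fordSmoothW0 θ * (x - 1) / ((x - 1) ^ 2 + t ^ 2)| ≤ η * fordSmoothW0 θ / t ^ 2 := by
    rw [abs_div, abs_of_pos hq, abs_mul, abs_of_pos (by positivity : 0 < η * fordSmoothW0 θ),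
      div_le_div_iff₀ hq ht2]
    have h1 : |x - 1| * t ^ 2 ≤ 1 * ((x - 1) ^ 2 + t ^ 2) := by nlinarith [abs_nonneg (x - 1), sq_abs (x - 1)]
    nlinarith [mul_le_mul_of_nonneg_left h1 (by positivity : 0 ≤ η * fordSmoothW0 θ)]
  have htri := abs_add_le ((fordLaplace (kadiriTest θ η) (((x - 1 : ℝ) : ℂ) + (t : ℂ) * I)).re -
      η * fordSmoothW0 θ * (x - 1) / ((x - 1) ^ 2 + t ^ 2))
    (η * fordSmoothW0 θ * (x - 1) / ((x - 1) ^ 2 + t ^ 2))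
  rw [sub_add_cancel] at htri
  rw [add_div]
  linarith

/-! ## The `Γ`-terms in the notation `kadiriT1` -/

/-- **Kadiri's Lemma 4.5, `k ≥ 1`**, in the notation of the master inequality: for `t ≥ 2`,
`0 < σ`, `δ, κ ≥ 0`, `κ(σ+2+δ) ≤ σ+2`,
`T₁(σ+it) − κT₁(σ+δ+it) ≤ ((1−κ)/2) log t − ((1−κ)/2) log 2π + ½ r(σ+2, t)`.
[cite: Kadiri2005, Lemma 4.5] -/
theorem kadiriT1_sub_le {σ δ κ t : ℝ} (hσ : 0 < σ) (hδ : 0 ≤ δ) (hκ0 : 0 ≤ κ)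
    (hκx : κ * (σ + 2 + δ) ≤ σ + 2) (ht : 2 ≤ t) :
    kadiriT1 ((σ : ℂ) + (t : ℂ) * I) - κ * kadiriT1 (((σ + δ : ℝ) : ℂ) + (t : ℂ) * I) ≤
      (1 - κ) / 2 * Real.log t - (1 - κ) / 2 * Real.log (2 * π) +
        (((σ + 2) ^ 2 / (2 * t ^ 2) + (1 + κ) * (4 / (3 * t ^ 3) + π / (3 * t ^ 2)))) / 2 := by
  unfold kadiriT1
  exact KadiriDigamma.T1_sub_mul_T1_le hσ hδ hκ0 hκx ht

/-- **Kadiri's Lemma 4.5, `k = 0`**, in the notation of the master inequality (the point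
`σ + i·0·γ₀`): for `0 < σ₀ ≤ σ ≤ 1`, `δ, κ ≥ 0`,
`T₁(σ) − κT₁(σ+δ) ≤ −((1−κ)/2) log π + ½ψ(3/2) − (κ/2)ψ((σ₀+δ)/2+1)`.
[cite: Kadiri2005, Lemma 4.5] -/
theorem kadiriT1_sub_le_zero {σ₀ σ δ κ γ₀ : ℝ} (hσ₀ : 0 < σ₀) (hσ₀σ : σ₀ ≤ σ) (hσ1 : σ ≤ 1)
    (hδ : 0 ≤ δ) (hκ0 : 0 ≤ κ) :
    kadiriT1 ((σ : ℂ) + ((((0 : ℕ) : ℝ) * γ₀ : ℝ) : ℂ) * I) -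
        κ * kadiriT1 (((σ + δ : ℝ) : ℂ) + ((((0 : ℕ) : ℝ) * γ₀ : ℝ) : ℂ) * I) ≤
      -((1 - κ) / 2) * Real.log π + (digamma ((3 / 2 : ℝ) : ℂ)).re / 2 -
        κ / 2 * (digamma ((((σ₀ + δ) / 2 + 1 : ℝ)) : ℂ)).re := by
  unfold kadiriT1
  simp only [Nat.cast_zero, zero_mul, Complex.ofReal_zero, add_zero]
  exact KadiriDigamma.T1_sub_mul_T1_le_zero hσ₀ hσ₀σ hσ1 hδ hκ0

/-! ## The `Γ`-remainder in the notation `kadiriT2` -/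

/-- **Kadiri's Lemma 4.7 with `M(z) ≤ m/z`**: for `x > 1/2`,
`|T₂(x + it)| ≤ mη³ [1/(x(x²+t²)) + J(x−½, t)/(2π(x−½))]`,
`J(a, t) = ∫ |Re ψ((1/2+iy)/2)| /(a² + (t−y)²) dy`. [cite: Kadiri2005, Lemma 4.7] -/
theorem abs_kadiriT2_le (hθ : 0 < θ) (hθ' : θ < π / 2) (hη : 0 < η) {m x t : ℝ} (hx : 1 / 2 < x)
    (hm : ∀ u ∈ Icc 0 (mtyD1 θ), |mtyH1Deriv2 1 θ u| ≤ m) :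
    |kadiriT2 (kadiriTest θ η) ((x : ℂ) + (t : ℂ) * I)| ≤
      m * η ^ 3 * (1 / (x * (x ^ 2 + t ^ 2)) + (∫ y : ℝ,
        |(digamma (((((1 / 2 : ℝ)) : ℂ) + y * I) / 2)).re| / ((x - 1 / 2) ^ 2 + (t - y) ^ 2)) /
          (2 * π * (x - 1 / 2))) := by
  have h := KadiriGamma.abs_T2_le hθ hθ' hη (σ := x) (t := t) hx
  unfold kadiriT2
  refine h.trans ?_
  set Jv : ℝ := ∫ y : ℝ, |(digamma (((((1 / 2 : ℝ)) : ℂ) + y * I) / 2)).re| /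
    ((x - 1 / 2) ^ 2 + (t - y) ^ 2) with hJv
  have hx0 : 0 < x := by linarith
  have ha0 : 0 < x - 1 / 2 := by linarith
  have hM1 : mtyM θ (x / η) ≤ m / (x / η) := KadiriBoundary.mtyM_le_div hθ hθ' hm (by positivity)
  have hM2 : mtyM θ ((x - 1 / 2) / η) ≤ m / ((x - 1 / 2) / η) :=
    KadiriBoundary.mtyM_le_div hθ hθ' hm (by positivity)
  have hJ0 : 0 ≤ Jv := integral_nonneg fun y ↦ by positivity
  have hq : 0 < x ^ 2 + t ^ 2 := by positivity
  have e1 : m / (x / η) * η ^ 2 / (x ^ 2 + t ^ 2) = m * η ^ 3 * (1 / (x * (x ^ 2 + t ^ 2))) := by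
    field_simp
  have e2 : m / ((x - 1 / 2) / η) * η ^ 2 / (2 * π) * Jv = m * η ^ 3 * (Jv / (2 * π * (x - 1 / 2))) := by
    field_simp
  have h1 : mtyM θ (x / η) * η ^ 2 / (x ^ 2 + t ^ 2) ≤ m * η ^ 3 * (1 / (x * (x ^ 2 + t ^ 2))) := by
    rw [← e1]; gcongr
  have h2 : mtyM θ ((x - 1 / 2) / η) * η ^ 2 / (2 * π) * Jv ≤ m * η ^ 3 * (Jv / (2 * π * (x - 1 / 2))) := by
    rw [← e2]; gcongr
  rw [mul_add]
  exact add_le_add h1 h2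

/-- `J(a, t)` is non-increasing in `a > 0`. [folklore] -/
theorem J_antitone {a a' t : ℝ} (ha : 0 < a) (haa' : a ≤ a') :
    (∫ y : ℝ, |(digamma (((((1 / 2 : ℝ)) : ℂ) + y * I) / 2)).re| / (a' ^ 2 + (t - y) ^ 2)) ≤
      ∫ y : ℝ, |(digamma (((((1 / 2 : ℝ)) : ℂ) + y * I) / 2)).re| / (a ^ 2 + (t - y) ^ 2) := by
  have hint : ∀ {c : ℝ}, 0 < c → Integrable fun y : ℝ ↦
      |(digamma (((((1 / 2 : ℝ)) : ℂ) + y * I) / 2)).re| / (c ^ 2 + (t - y) ^ 2) := by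
    intro c hc
    have h := KadiriGamma.integrable_T2_majorant (a := c) (t := t) (A := 12) (B := 1) hc (by norm_num)
      zero_le_one
    refine h.mono' ?_ (ae_of_all _ fun y ↦ ?_)
    · refine (Continuous.div ?_ (by fun_prop) fun y ↦ by positivity).aestronglyMeasurable
      refine continuous_abs.comp ?_
      exact (Complex.continuous_re.comp SmoothedEF.continuous_re_digamma_half_line).congr
        fun y ↦ by simp [Function.comp]
    · rw [Real.norm_eq_abs, abs_div, abs_abs, abs_of_pos (by positivity : 0 < c ^ 2 + (t - y) ^ 2)]
      rw [mul_one_div]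
      exact div_le_div_of_nonneg_right (KadiriGamma.abs_re_digamma_le y) (by positivity)
  refine integral_mono (hint (ha.trans_le haa')) (hint ha) fun y ↦ ?_
  exact div_le_div_of_nonneg_left (abs_nonneg _) (by positivity) (by nlinarith)

/-! ## Elementary inequalities for the large-height terms -/

/-- `log(x + 7) ≤ log x + 1` for `x ≥ 7`. [folklore] -/
theorem log_add_seven_le {x : ℝ} (hx : 7 ≤ x) : Real.log (x + 7) ≤ Real.log x + 1 := by
  have h1 : Real.log (x + 7) ≤ Real.log (2 * x) := Real.log_le_log (by linarith) (by linarith)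
  rw [Real.log_mul two_ne_zero (by linarith)] at h1
  have h2 : Real.log 2 < 1 := by
    have := Real.log_two_lt_d9; linarith
  linarith

/-- The `Γ`-error `r(σ+2, t)/2 ≤ 5/T₀²` for `t ≥ T₀ ≥ 1`, `0 < σ ≤ 1`, `0 ≤ κ ≤ 1`. [folklore] -/
theorem gammaErr_le {σ κ t T₀ : ℝ} (hσ : 0 < σ) (hσ1 : σ ≤ 1) (hκ1 : κ ≤ 1)
    (hT₀ : 1 ≤ T₀) (ht : T₀ ≤ t) :
    (((σ + 2) ^ 2 / (2 * t ^ 2) + (1 + κ) * (4 / (3 * t ^ 3) + π / (3 * t ^ 2)))) / 2 ≤ 5 / T₀ ^ 2 := by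
  have ht0 : 1 ≤ t := hT₀.trans ht
  have hπ := Real.pi_lt_d2
  have h1 : 1 / t ^ 2 ≤ 1 / T₀ ^ 2 := one_div_le_one_div_of_le (by positivity) (by nlinarith)
  have h2 : 1 / t ^ 3 ≤ 1 / T₀ ^ 2 := by
    refine le_trans ?_ h1
    apply one_div_le_one_div_of_le (by positivity)
    nlinarith [pow_le_pow_right₀ ht0 (by norm_num : 2 ≤ 3)]
  have e1 : (σ + 2) ^ 2 / (2 * t ^ 2) = (σ + 2) ^ 2 / 2 * (1 / t ^ 2) := by field_simp
  have e2 : 4 / (3 * t ^ 3) = 4 / 3 * (1 / t ^ 3) := by field_simp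
  have e3 : π / (3 * t ^ 2) = π / 3 * (1 / t ^ 2) := by field_simp
  rw [e1, e2, e3]
  have hσ2 : (σ + 2) ^ 2 / 2 ≤ 9 / 2 := by nlinarith
  have hT2 : 0 < 1 / T₀ ^ 2 := by positivity
  have : (σ + 2) ^ 2 / 2 * (1 / t ^ 2) ≤ 9 / 2 * (1 / T₀ ^ 2) :=
    mul_le_mul hσ2 h1 (by positivity) (by norm_num)
  have : (1 + κ) * (4 / 3 * (1 / t ^ 3) + π / 3 * (1 / t ^ 2)) ≤ 2 * (4 / 3 * (1 / T₀ ^ 2) + 3.15 / 3 * (1 / T₀ ^ 2)) := by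
    refine mul_le_mul (by linarith) ?_ (by positivity) (by norm_num)
    have : π / 3 * (1 / t ^ 2) ≤ 3.15 / 3 * (1 / T₀ ^ 2) :=
      mul_le_mul (by linarith) h1 (by positivity) (by norm_num)
    nlinarith
  have e4 : (5 : ℝ) / T₀ ^ 2 = 5 * (1 / T₀ ^ 2) := by ring
  rw [e4]
  nlinarith

/-! ## The explicit master inequality -/

/-- **The terms of the master inequality at `k = 0`, explicitly.** [cite: Kadiri2005, (3.10)] -/
theorem term_zero_le (hθ : 0 < θ) (hθ' : θ < π / 2) (hη : 0 < η) {σ₀ σ δ κ γ₀ t₀ Mst m J₀ : ℝ}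
    (hσ₀ : 1 / 2 < σ₀) (hσ₀σ : σ₀ ≤ σ) (hσ1 : σ ≤ 1) (hδ : 0 ≤ δ) (hδ1 : δ ≤ 1) (hκ0 : 0 ≤ κ)
    (hm : ∀ u ∈ Icc 0 (mtyD1 θ), |mtyH1Deriv2 1 θ u| ≤ m)
    (hJ0 : (∫ y : ℝ, |(digamma (((((1 / 2 : ℝ)) : ℂ) + y * I) / 2)).re| /
      ((σ₀ - 1 / 2) ^ 2 + (0 - y) ^ 2)) ≤ J₀) :
    kadiriTest θ η 0 * (kadiriT1 ((σ : ℂ) + ((((0 : ℕ) : ℝ) * γ₀ : ℝ) : ℂ) * I) -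
        κ * kadiriT1 (((σ + δ : ℝ) : ℂ) + ((((0 : ℕ) : ℝ) * γ₀ : ℝ) : ℂ) * I)) +
      ((fordLaplace (kadiriTest θ η) ((σ : ℂ) + ((((0 : ℕ) : ℝ) * γ₀ : ℝ) : ℂ) * I - 1)).re -
        κ * (fordLaplace (kadiriTest θ η) (((σ + δ : ℝ) : ℂ) + ((((0 : ℕ) : ℝ) * γ₀ : ℝ) : ℂ) * I - 1)).re) +
      (kadiriT2 (kadiriTest θ η) ((σ : ℂ) + ((((0 : ℕ) : ℝ) * γ₀ : ℝ) : ℂ) * I) -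
        κ * kadiriT2 (kadiriTest θ η) (((σ + δ : ℝ) : ℂ) + ((((0 : ℕ) : ℝ) * γ₀ : ℝ) : ℂ) * I)) +
      (1 + κ) * Mst * η ^ 2 * (3 * KadiriTail.tailBound (((0 : ℕ) : ℝ) * γ₀) t₀) ≤
    η * fordSmoothW0 θ * (-((1 - κ) / 2) * Real.log π + (digamma ((3 / 2 : ℝ) : ℂ)).re / 2 -
        κ / 2 * (digamma ((((σ₀ + δ) / 2 + 1 : ℝ)) : ℂ)).re) +
      (mtyLaplace θ ((σ - 1) / η) - κ * mtyLaplace θ ((σ + δ - 1) / η)) +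
      (1 + κ) * (m * η ^ 3) * (1 / σ₀ ^ 3 + J₀ / (2 * π * (σ₀ - 1 / 2))) +
      (1 + κ) * Mst * η ^ 2 * (3 * KadiriTail.tailBound 0 t₀) := by
  have hg0 : 0 < fordSmoothW0 θ := fordSmoothW0_pos hθ hθ'
  have hf0 : kadiriTest θ η 0 = η * fordSmoothW0 θ := KadiriTest.map_zero hθ hθ'
  have hm0 : 0 ≤ m := (abs_nonneg _).trans (hm 0 ⟨le_rfl, (KadiriTest.mtyD1_pos hθ hθ').le⟩)
  refine add_le_add (add_le_add (add_le_add ?_ ?_) ?_) ?_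
  · -- Γ-terms
    rw [hf0]
    exact mul_le_mul_of_nonneg_left (kadiriT1_sub_le_zero (by linarith) hσ₀σ hσ1 hδ hκ0) (by positivity)
  · -- poles (exact)
    rw [re_fordLaplace_pole_zero hθ hθ' hη, re_fordLaplace_pole_zero hθ hθ' hη]
  · -- Γ-remainders
    have e0 : ((((0 : ℕ) : ℝ) * γ₀ : ℝ) : ℂ) * I = ((0 : ℝ) : ℂ) * I := by simp
    rw [e0]
    have ha₀ : 0 < σ₀ - 1 / 2 := by linarith
    have hJ0nn : ∀ {a t : ℝ}, 0 ≤ ∫ y : ℝ, |(digamma (((((1 / 2 : ℝ)) : ℂ) + y * I) / 2)).re| /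
        (a ^ 2 + (t - y) ^ 2) := fun {a t} ↦ integral_nonneg fun y ↦ by positivity
    have hJ0' : 0 ≤ J₀ := hJ0nn.trans hJ0
    have key : ∀ {x c : ℝ}, σ₀ ≤ x → x ≤ 2 → 0 ≤ c →
        c * kadiriT2 (kadiriTest θ η) ((x : ℂ) + ((0 : ℝ) : ℂ) * I) ≤
          c * (m * η ^ 3) * (1 / σ₀ ^ 3 + J₀ / (2 * π * (σ₀ - 1 / 2))) := by
      intro x c hx hx2 hc
      rw [mul_assoc]
      refine mul_le_mul_of_nonneg_left ?_ hc
      have hx' : 1 / 2 < x := by linarith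
      have h1 := (le_abs_self _).trans (abs_kadiriT2_le hθ hθ' hη (t := 0) hx' hm)
      have hx0 : 0 < x := by linarith
      have h2π : 0 < 2 * π := by positivity
      refine h1.trans (mul_le_mul_of_nonneg_left (add_le_add ?_ ?_) (by positivity))
      · rw [one_div_le_one_div (mul_pos hx0 (by positivity)) (by positivity)]
        have : σ₀ ^ 3 ≤ x ^ 3 := pow_le_pow_left₀ (by linarith) hx 3
        nlinarith
      · have hJ1 := J_antitone (t := 0) ha₀ (by linarith : σ₀ - 1 / 2 ≤ x - 1 / 2)
        have hJx := hJ1.trans hJ0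
        have hd1 : 0 < 2 * π * (x - 1 / 2) := mul_pos h2π (by linarith)
        have hd0 : 0 < 2 * π * (σ₀ - 1 / 2) := mul_pos h2π ha₀
        calc (∫ y : ℝ, |(digamma (((((1 / 2 : ℝ)) : ℂ) + y * I) / 2)).re| /
              ((x - 1 / 2) ^ 2 + (0 - y) ^ 2)) / (2 * π * (x - 1 / 2))
            ≤ J₀ / (2 * π * (x - 1 / 2)) := div_le_div_of_nonneg_right hJx hd1.le
          _ ≤ J₀ / (2 * π * (σ₀ - 1 / 2)) :=
              div_le_div_of_nonneg_left hJ0' hd0 (mul_le_mul_of_nonneg_left (by linarith) h2π.le)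
    have h1 := key (x := σ) (c := 1) hσ₀σ (by linarith) zero_le_one
    have h2 := key (x := σ + δ) (c := κ) (by linarith) (by linarith [hσ1]) hκ0
    have hb : |kadiriT2 (kadiriTest θ η) ((((σ + δ : ℝ)) : ℂ) + ((0 : ℝ) : ℂ) * I)| ≤
        (m * η ^ 3) * (1 / σ₀ ^ 3 + J₀ / (2 * π * (σ₀ - 1 / 2))) := by
      refine (abs_kadiriT2_le hθ hθ' hη (x := σ + δ) (t := 0) (by linarith) hm).trans ?_
      have hx0 : 0 < σ + δ := by linarith
      have h2π : 0 < 2 * π := by positivity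
      refine mul_le_mul_of_nonneg_left (add_le_add ?_ ?_) (by positivity)
      · rw [one_div_le_one_div (mul_pos hx0 (by positivity)) (by positivity)]
        have : σ₀ ^ 3 ≤ (σ + δ) ^ 3 := pow_le_pow_left₀ (by linarith) (by linarith) 3
        nlinarith
      · have hJ1 := J_antitone (t := 0) ha₀ (by linarith : σ₀ - 1 / 2 ≤ σ + δ - 1 / 2)
        have hJx := hJ1.trans hJ0
        have hpos : 0 < 2 * π * (σ + δ - 1 / 2) := mul_pos h2π (by linarith)
        have hd0 : 0 < 2 * π * (σ₀ - 1 / 2) := mul_pos h2π ha₀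
        calc (∫ y : ℝ, |(digamma (((((1 / 2 : ℝ)) : ℂ) + y * I) / 2)).re| /
              ((σ + δ - 1 / 2) ^ 2 + (0 - y) ^ 2)) / (2 * π * (σ + δ - 1 / 2))
            ≤ J₀ / (2 * π * (σ + δ - 1 / 2)) := div_le_div_of_nonneg_right hJx hpos.le
          _ ≤ J₀ / (2 * π * (σ₀ - 1 / 2)) :=
              div_le_div_of_nonneg_left hJ0' hd0 (mul_le_mul_of_nonneg_left (by linarith) h2π.le)
    have h3 := mul_le_mul_of_nonneg_left ((neg_le_abs _).trans hb) hκ0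
    simp only [one_mul] at h1
    linarith [h1, h3]
  · -- tails (equal)
    simp

/-- **The terms of the master inequality at `k ≥ 1`, explicitly** (`t = kγ₀ ≥ γ₀ ≥ T₀ ≥ 7`,
`log(kγ₀) = log k + log γ₀`). [cite: Kadiri2005, (3.10)] -/
theorem term_pos_le (hθ : 0 < θ) (hθ' : θ < π / 2) (hη : 0 < η) {σ₀ σ δ κ γ₀ t₀ T₀ Mst m αJ βJ : ℝ}
    (hσ₀ : 1 / 2 < σ₀) (hσ₀σ : σ₀ ≤ σ) (hσ1 : σ ≤ 1) (hδ : 0 ≤ δ) (hδ1 : δ < 1) (hκ0 : 0 ≤ κ)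
    (hκ1 : κ ≤ 1) (hκΓ : κ * (σ + 2 + δ) ≤ σ + 2) (hT₀ : 7 ≤ T₀) (hγ₀ : T₀ ≤ γ₀) (ht₀ : 1 ≤ t₀)
    (hm : ∀ u ∈ Icc 0 (mtyD1 θ), |mtyH1Deriv2 1 θ u| ≤ m)
    (hM : ∀ x : ℝ, σ - 1 ≤ x → mtyM θ (x / η) ≤ Mst)
    (hJ : ∀ t : ℝ, T₀ ≤ t → (∫ y : ℝ, |(digamma (((((1 / 2 : ℝ)) : ℂ) + y * I) / 2)).re| /
      ((σ₀ - 1 / 2) ^ 2 + (t - y) ^ 2)) ≤ αJ * Real.log t + βJ)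
    {k : ℕ} (hk : 1 ≤ k) :
    kadiriTest θ η 0 * (kadiriT1 ((σ : ℂ) + (((k : ℝ) * γ₀ : ℝ) : ℂ) * I) -
        κ * kadiriT1 (((σ + δ : ℝ) : ℂ) + (((k : ℝ) * γ₀ : ℝ) : ℂ) * I)) +
      ((fordLaplace (kadiriTest θ η) ((σ : ℂ) + (((k : ℝ) * γ₀ : ℝ) : ℂ) * I - 1)).re -
        κ * (fordLaplace (kadiriTest θ η) (((σ + δ : ℝ) : ℂ) + (((k : ℝ) * γ₀ : ℝ) : ℂ) * I - 1)).re) +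
      (kadiriT2 (kadiriTest θ η) ((σ : ℂ) + (((k : ℝ) * γ₀ : ℝ) : ℂ) * I) -
        κ * kadiriT2 (kadiriTest θ η) (((σ + δ : ℝ) : ℂ) + (((k : ℝ) * γ₀ : ℝ) : ℂ) * I)) +
      (1 + κ) * Mst * η ^ 2 * (3 * KadiriTail.tailBound ((k : ℝ) * γ₀) t₀) ≤
    η * fordSmoothW0 θ * ((1 - κ) / 2 * (Real.log k + Real.log γ₀) - (1 - κ) / 2 * Real.log (2 * π) +
        5 / T₀ ^ 2) +
      (1 + κ) * (η * fordSmoothW0 θ + Mst * η ^ 2) / T₀ ^ 2 +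
      (1 + κ) * (m * η ^ 3) * (2 / T₀ ^ 2 + (αJ * (Real.log k + Real.log γ₀) + βJ) / (2 * π * (σ₀ - 1 / 2))) +
      (1 + κ) * Mst * η ^ 2 * (3 * ((154 + 30 * (Real.log k + Real.log γ₀ + 1)) * (1 / t₀ ^ 2 + 1 / t₀) +
        30 * (Real.log t₀ / t₀ ^ 2 + (Real.log t₀ + 1) / t₀))) := by
  have hg0 : 0 < fordSmoothW0 θ := fordSmoothW0_pos hθ hθ'
  have hf0 : kadiriTest θ η 0 = η * fordSmoothW0 θ := KadiriTest.map_zero hθ hθ'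
  have hm0 : 0 ≤ m := (abs_nonneg _).trans (hm 0 ⟨le_rfl, (KadiriTest.mtyD1_pos hθ hθ').le⟩)
  have hMst0 : 0 ≤ Mst := (KadiriTest.mtyM_nonneg hθ hθ' _).trans (hM σ (by linarith))
  have hk1 : (1 : ℝ) ≤ k := by exact_mod_cast hk
  set t : ℝ := (k : ℝ) * γ₀ with htdef
  have hγ7 : 7 ≤ γ₀ := hT₀.trans hγ₀
  have htγ : γ₀ ≤ t := by rw [htdef]; nlinarith
  have htT : T₀ ≤ t := hγ₀.trans htγ
  have ht7 : 7 ≤ t := hT₀.trans htT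
  have ht0 : 0 < t := by linarith
  have hlogt : Real.log t = Real.log k + Real.log γ₀ := by
    rw [htdef, Real.log_mul (by positivity) (by linarith)]
  have ht2 : 1 / t ^ 2 ≤ 1 / T₀ ^ 2 := one_div_le_one_div_of_le (by positivity) (by nlinarith)
  refine add_le_add (add_le_add (add_le_add ?_ ?_) ?_) ?_
  · -- Γ-terms
    rw [hf0, ← hlogt]
    refine mul_le_mul_of_nonneg_left ?_ (by positivity)
    have h := kadiriT1_sub_le (σ := σ) (δ := δ) (κ := κ) (t := t) (by linarith) hδ hκ0 hκΓ (by linarith)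
    have hr := gammaErr_le (σ := σ) (κ := κ) (t := t) (T₀ := T₀) (by linarith) hσ1 hκ1 (by linarith) htT
    linarith
  · -- poles
    have h1 := abs_re_fordLaplace_pole_le hθ hθ' hη (x := σ) (t := t) (Mst := Mst)
      (by rw [abs_le]; constructor <;> linarith) ht0.ne' (hM (σ - 1) le_rfl)
    have h2 := abs_re_fordLaplace_pole_le hθ hθ' hη (x := σ + δ) (t := t) (Mst := Mst)
      (by rw [abs_le]; constructor <;> linarith) ht0.ne' (hM (σ + δ - 1) (by linarith))
    have hb0 : 0 ≤ (η * fordSmoothW0 θ + Mst * η ^ 2) := by positivity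
    have hbt : (η * fordSmoothW0 θ + Mst * η ^ 2) / t ^ 2 ≤ (η * fordSmoothW0 θ + Mst * η ^ 2) / T₀ ^ 2 := by
      rw [div_eq_mul_one_div, div_eq_mul_one_div _ (T₀ ^ 2)]
      exact mul_le_mul_of_nonneg_left ht2 hb0
    have hA := ((le_abs_self _).trans h1).trans hbt
    have hBκ := mul_le_mul_of_nonneg_left (((neg_le_abs _).trans h2).trans hbt) hκ0
    have e2 : (1 + κ) * (η * fordSmoothW0 θ + Mst * η ^ 2) / T₀ ^ 2 =
        (η * fordSmoothW0 θ + Mst * η ^ 2) / T₀ ^ 2 + κ * ((η * fordSmoothW0 θ + Mst * η ^ 2) / T₀ ^ 2) := by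
      ring
    rw [e2]
    linarith
  · -- Γ-remainders
    have ha₀ : 0 < σ₀ - 1 / 2 := by linarith
    have hJnn : ∀ {a : ℝ}, 0 ≤ ∫ y : ℝ, |(digamma (((((1 / 2 : ℝ)) : ℂ) + y * I) / 2)).re| /
        (a ^ 2 + (t - y) ^ 2) := fun {a} ↦ integral_nonneg fun y ↦ by positivity
    have hJt := hJ t htT
    have hJb0 : 0 ≤ αJ * Real.log t + βJ := hJnn.trans hJt
    have key : ∀ {x : ℝ}, σ₀ ≤ x → x ≤ 2 →
        |kadiriT2 (kadiriTest θ η) ((x : ℂ) + (t : ℂ) * I)| ≤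
          (m * η ^ 3) * (2 / T₀ ^ 2 + (αJ * Real.log t + βJ) / (2 * π * (σ₀ - 1 / 2))) := by
      intro x hx hx2
      have hx' : 1 / 2 < x := by linarith
      refine (abs_kadiriT2_le hθ hθ' hη (x := x) (t := t) hx' hm).trans ?_
      have hx0 : 0 < x := by linarith
      have h2π : 0 < 2 * π := by positivity
      refine mul_le_mul_of_nonneg_left (add_le_add ?_ ?_) (by positivity)
      · have hxt : 1 / 2 * t ^ 2 ≤ x * (x ^ 2 + t ^ 2) := by
          nlinarith [sq_nonneg x, mul_pos ht0 ht0, mul_nonneg hx0.le (sq_nonneg x)]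
        calc 1 / (x * (x ^ 2 + t ^ 2)) ≤ 1 / (1 / 2 * t ^ 2) :=
              one_div_le_one_div_of_le (by positivity) hxt
          _ = 2 * (1 / t ^ 2) := by field_simp
          _ ≤ 2 * (1 / T₀ ^ 2) := by linarith
          _ = 2 / T₀ ^ 2 := by ring
      · have hJ1 := J_antitone (t := t) ha₀ (by linarith : σ₀ - 1 / 2 ≤ x - 1 / 2)
        have hJx := hJ1.trans hJt
        have hd1 : 0 < 2 * π * (x - 1 / 2) := mul_pos h2π (by linarith)
        have hd0 : 0 < 2 * π * (σ₀ - 1 / 2) := mul_pos h2π ha₀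
        calc (∫ y : ℝ, |(digamma (((((1 / 2 : ℝ)) : ℂ) + y * I) / 2)).re| /
              ((x - 1 / 2) ^ 2 + (t - y) ^ 2)) / (2 * π * (x - 1 / 2))
            ≤ (αJ * Real.log t + βJ) / (2 * π * (x - 1 / 2)) := div_le_div_of_nonneg_right hJx hd1.le
          _ ≤ (αJ * Real.log t + βJ) / (2 * π * (σ₀ - 1 / 2)) :=
              div_le_div_of_nonneg_left hJb0 hd0 (mul_le_mul_of_nonneg_left (by linarith) h2π.le)
    have h1 := (le_abs_self _).trans (key (x := σ) hσ₀σ (by linarith))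
    have h2 := mul_le_mul_of_nonneg_left ((neg_le_abs _).trans (key (x := σ + δ) (by linarith) (by linarith)))
      hκ0
    rw [← hlogt]
    linarith [h1, h2]
  · -- tails
    have hB : KadiriTail.tailBound t t₀ ≤ (154 + 30 * (Real.log k + Real.log γ₀ + 1)) * (1 / t₀ ^ 2 + 1 / t₀) +
        30 * (Real.log t₀ / t₀ ^ 2 + (Real.log t₀ + 1) / t₀) := by
      unfold KadiriTail.tailBound
      have hl := log_add_seven_le ht7
      rw [hlogt] at hl
      have h0 : 0 ≤ 1 / t₀ ^ 2 + 1 / t₀ := by positivity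
      have := mul_le_mul_of_nonneg_right
        (by linarith : 154 + 30 * Real.log (t + 7) ≤ 154 + 30 * (Real.log k + Real.log γ₀ + 1)) h0
      linarith
    have hc : 0 ≤ (1 + κ) * Mst * η ^ 2 := by positivity
    exact mul_le_mul_of_nonneg_left (mul_le_mul_of_nonneg_left hB (by norm_num)) hc

/-- **The explicit master inequality** (Kadiri (3.10) / Mossinghoff–Trudgian (2.2) before
dividing out): for the zero `ρ₀ = β₀ + iγ₀` with `1 − η ≤ β₀ ≤ σ`, under the hypotheses of
`KadiriMaster.master_ineq` and the explicit bounds of this file,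
`a₁[L((σ−1)/η + 1)·… ] ≤ a₀ · Bound₀ + Σ_{k=1}^{n} a_k · Bound_k` with `Bound₀`, `Bound_k` the
right-hand sides of `term_zero_le`, `term_pos_le` (the `L`-values, `log k`, `log γ₀`, and the
numerical inputs `M*`, `m`, `J₀`, `αJ`, `βJ`). [cite: Kadiri2005, (3.10)] -/
theorem master_explicit (hθ : 0 < θ) (hθ' : θ < π / 2) (hη : 0 < η)
    {σ₀ σ δ κ γ₀ t₀ T₀ Mst m J₀ αJ βJ : ℝ} {K : ℕ} {b : ℕ → ℝ} (hb : IsNonnegTrigPoly K b)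
    (hK : 1 ≤ K) (hσ₀ : 1 / 2 < σ₀) (hσ₀σ : σ₀ ≤ σ) (hσ1 : σ < 1) (hδ : 0 ≤ δ) (hδ1 : δ < 1)
    (hδσ : 2 * (1 - σ) ≤ δ) (hκ0 : 0 ≤ κ) (hκ1 : κ ≤ 1) (hκΓ : κ * (σ + 2 + δ) ≤ σ + 2)
    (hT₀ : 7 ≤ T₀) (hγ₀ : T₀ ≤ γ₀) (ht₀ : 4 ≤ t₀)
    (hζ : ∀ k ≤ K, riemannZeta ((σ : ℂ) + (((k : ℝ) * γ₀ : ℝ) : ℂ) * I) ≠ 0)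
    (hζ' : ∀ k ≤ K, riemannZeta (((σ + δ : ℝ) : ℂ) + (((k : ℝ) * γ₀ : ℝ) : ℂ) * I) ≠ 0)
    (hnear : ∀ k ≤ K, ∀ ρ : Zeros, |(ρ : ℂ).im - (k : ℝ) * γ₀| < t₀ →
      1 - σ ≤ (ρ : ℂ).re ∧ (ρ : ℂ).re ≤ σ)
    (hB : ∀ y : ℝ, κ * ((fordLaplace (kadiriTest θ η) ((δ : ℂ) + y * I)).re +
        (fordLaplace (kadiriTest θ η) (((2 * σ - 1 + δ : ℝ) : ℂ) + y * I)).re) ≤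
      (fordLaplace (kadiriTest θ η) (((0 : ℝ) : ℂ) + y * I)).re +
        (fordLaplace (kadiriTest θ η) (((2 * σ - 1 : ℝ) : ℂ) + y * I)).re)
    (hA : κ * (2 * σ - 1 + 2 * δ) ≤ 2 * σ - 1)
    (hSt : κ * (2 * σ - 1 + 2 * δ) * (-(1 - σ) + (2 * σ - 1) * δ + δ ^ 2 + t₀ ^ 2) ≤
      (2 * σ - 1) * (-(1 - σ) + t₀ ^ 2))
    (hM : ∀ x : ℝ, σ - 1 ≤ x → mtyM θ (x / η) ≤ Mst)
    (hm : ∀ u ∈ Icc 0 (mtyD1 θ), |mtyH1Deriv2 1 θ u| ≤ m)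
    (hJ0 : (∫ y : ℝ, |(digamma (((((1 / 2 : ℝ)) : ℂ) + y * I) / 2)).re| /
      ((σ₀ - 1 / 2) ^ 2 + (0 - y) ^ 2)) ≤ J₀)
    (hJ : ∀ t : ℝ, T₀ ≤ t → (∫ y : ℝ, |(digamma (((((1 / 2 : ℝ)) : ℂ) + y * I) / 2)).re| /
      ((σ₀ - 1 / 2) ^ 2 + (t - y) ^ 2)) ≤ αJ * Real.log t + βJ)
    (ρ₀ : Zeros) (hρ₀ : (ρ₀ : ℂ).im = γ₀) (hβlow : 1 - η ≤ (ρ₀ : ℂ).re) (hβσ : (ρ₀ : ℂ).re ≤ σ)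
    (hη2 : η < 1 / 2) :
    b 1 * (mtyLaplace θ ((σ - (1 - η)) / η) + mtyLaplace θ (1 / η) -
        κ * (mtyLaplace θ (δ / η) + mtyLaplace θ ((σ + δ - 1 + (1 - η)) / η))) ≤
      b 0 * (η * fordSmoothW0 θ * (-((1 - κ) / 2) * Real.log π + (digamma ((3 / 2 : ℝ) : ℂ)).re / 2 -
            κ / 2 * (digamma ((((σ₀ + δ) / 2 + 1 : ℝ)) : ℂ)).re) +
          (mtyLaplace θ ((σ - 1) / η) - κ * mtyLaplace θ ((σ + δ - 1) / η)) +
          (1 + κ) * (m * η ^ 3) * (1 / σ₀ ^ 3 + J₀ / (2 * π * (σ₀ - 1 / 2))) +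
          (1 + κ) * Mst * η ^ 2 * (3 * KadiriTail.tailBound 0 t₀)) +
      ∑ k ∈ Finset.range K, b (k + 1) *
        (η * fordSmoothW0 θ * ((1 - κ) / 2 * (Real.log ((k + 1 : ℕ) : ℝ) + Real.log γ₀) -
            (1 - κ) / 2 * Real.log (2 * π) + 5 / T₀ ^ 2) +
          (1 + κ) * (η * fordSmoothW0 θ + Mst * η ^ 2) / T₀ ^ 2 +
          (1 + κ) * (m * η ^ 3) * (2 / T₀ ^ 2 +
            (αJ * (Real.log ((k + 1 : ℕ) : ℝ) + Real.log γ₀) + βJ) / (2 * π * (σ₀ - 1 / 2))) +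
          (1 + κ) * Mst * η ^ 2 * (3 * ((154 + 30 * (Real.log ((k + 1 : ℕ) : ℝ) + Real.log γ₀ + 1)) *
            (1 / t₀ ^ 2 + 1 / t₀) + 30 * (Real.log t₀ / t₀ ^ 2 + (Real.log t₀ + 1) / t₀)))) := by
  have hb0 : ∀ k, 0 ≤ b k := hb.1
  have hσ : 1 / 2 < σ := by linarith
  have hβ₀ : 1 / 2 < (ρ₀ : ℂ).re := by linarith
  have hρ₀' : |(ρ₀ : ℂ).im - γ₀| < t₀ := by rw [hρ₀, sub_self, abs_zero]; linarith
  have hmaster := KadiriMaster.master_ineq hθ hθ' hη hb hK hσ hσ1 hδ hδ1 hδσ hκ0 hκ1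
    (by linarith) ht₀ hζ hζ' hnear hB hA hSt hM ρ₀ hρ₀' hβ₀
  rw [Finset.sum_range_succ'] at hmaster
  -- the kept pair
  have hpair := pairVal_self_ge hθ hθ' hη (σ := σ) (δ := δ) (κ := κ) (t := γ₀) (β := (ρ₀ : ℂ).re)
    (βlow := 1 - η) hβlow hβσ (by linarith) hσ1.le hκ0
  rw [← hρ₀] at hpair
  have hρ₀im : (ρ₀ : ℂ).im = γ₀ := hρ₀
  rw [hρ₀im] at hpair
  have hL : b 1 * (mtyLaplace θ ((σ - (1 - η)) / η) + mtyLaplace θ (1 / η) -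
      κ * (mtyLaplace θ (δ / η) + mtyLaplace θ ((σ + δ - 1 + (1 - η)) / η))) ≤
      b 1 * KadiriZeroSum.pairVal θ η σ δ κ γ₀ (ρ₀ : ℂ).re γ₀ :=
    mul_le_mul_of_nonneg_left hpair (hb0 1)
  -- the `k = 0` term
  have h0 := mul_le_mul_of_nonneg_left (term_zero_le hθ hθ' hη (γ₀ := γ₀) (t₀ := t₀) (Mst := Mst)
    hσ₀ hσ₀σ hσ1.le hδ hδ1.le hκ0 hm hJ0) (hb0 0)
  -- the `k ≥ 1` terms
  have hpos : ∑ k ∈ Finset.range K, b (k + 1) *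
      (kadiriTest θ η 0 * (kadiriT1 ((σ : ℂ) + ((((k + 1 : ℕ) : ℝ) * γ₀ : ℝ) : ℂ) * I) -
          κ * kadiriT1 (((σ + δ : ℝ) : ℂ) + ((((k + 1 : ℕ) : ℝ) * γ₀ : ℝ) : ℂ) * I)) +
        ((fordLaplace (kadiriTest θ η) ((σ : ℂ) + ((((k + 1 : ℕ) : ℝ) * γ₀ : ℝ) : ℂ) * I - 1)).re -
          κ * (fordLaplace (kadiriTest θ η)
            (((σ + δ : ℝ) : ℂ) + ((((k + 1 : ℕ) : ℝ) * γ₀ : ℝ) : ℂ) * I - 1)).re) +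
        (kadiriT2 (kadiriTest θ η) ((σ : ℂ) + ((((k + 1 : ℕ) : ℝ) * γ₀ : ℝ) : ℂ) * I) -
          κ * kadiriT2 (kadiriTest θ η) (((σ + δ : ℝ) : ℂ) + ((((k + 1 : ℕ) : ℝ) * γ₀ : ℝ) : ℂ) * I)) +
        (1 + κ) * Mst * η ^ 2 * (3 * KadiriTail.tailBound (((k + 1 : ℕ) : ℝ) * γ₀) t₀)) ≤
      ∑ k ∈ Finset.range K, b (k + 1) *
        (η * fordSmoothW0 θ * ((1 - κ) / 2 * (Real.log ((k + 1 : ℕ) : ℝ) + Real.log γ₀) -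
            (1 - κ) / 2 * Real.log (2 * π) + 5 / T₀ ^ 2) +
          (1 + κ) * (η * fordSmoothW0 θ + Mst * η ^ 2) / T₀ ^ 2 +
          (1 + κ) * (m * η ^ 3) * (2 / T₀ ^ 2 +
            (αJ * (Real.log ((k + 1 : ℕ) : ℝ) + Real.log γ₀) + βJ) / (2 * π * (σ₀ - 1 / 2))) +
          (1 + κ) * Mst * η ^ 2 * (3 * ((154 + 30 * (Real.log ((k + 1 : ℕ) : ℝ) + Real.log γ₀ + 1)) *
            (1 / t₀ ^ 2 + 1 / t₀) + 30 * (Real.log t₀ / t₀ ^ 2 + (Real.log t₀ + 1) / t₀)))) := by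
    refine Finset.sum_le_sum fun k _ ↦ mul_le_mul_of_nonneg_left ?_ (hb0 (k + 1))
    exact term_pos_le hθ hθ' hη hσ₀ hσ₀σ hσ1.le hδ hδ1 hκ0 hκ1 hκΓ hT₀ hγ₀ (by linarith) hm hM hJ
      (k := k + 1) (by omega)
  have hγim : KadiriZeroSum.pairVal θ η σ δ κ γ₀ (ρ₀ : ℂ).re (ρ₀ : ℂ).im =
      KadiriZeroSum.pairVal θ η σ δ κ γ₀ (ρ₀ : ℂ).re γ₀ := by rw [hρ₀im]
  rw [hγim] at hmaster
  have hfin := hL.trans (hmaster.trans (add_le_add hpos h0))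
  exact hfin.trans_eq (add_comm _ _)

end KadiriExplicit

end Literature.NumberTheory.LFunctions
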